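import Summits.Ventures.Crystal3D.Kissing125.SearchFinal
import Summits.Ventures.Crystal3D.Bulk.GapReductionSharp
import Summits.Ventures.Crystal3D.StickySpheres.FccAllN
import Summits.Ventures.Crystal3D.Bulk.HoleForm
import Summits.Ventures.Crystal3D.Bulk.CapX2BoxW0625
import HarnessLib

/-!
# BIMODAL(1.25) and the census-free bulk theorem `K = 130` — the K-path head (computational grade), slim imports

Cell pub-crystal3d (AtomisticToContinuum venture), K-path at `h = 5/4`; filed LAST (RULING #194 (2) / #228 (4)),
in the SLIM shape R1 of RULING #234 (3): this module imports only `Kissing125.SearchFinal` (BIMODAL side) and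
`Bulk.GapReductionSharp`, `StickySpheres.FccAllN`, `Bulk.HoleForm`, `Bulk.CapX2BoxW0625` (GAP side + counting),
so that its import closure carries exactly the kernel evaluations the head depends on (the 256 parts of the
`κ = 7/32` run and the 67 `W0625` interval checks) and none of the `κ₀ = 0.797` run, the `W06225` pieces or
`Bulk.BulkConstant130` / `Bulk.BulkOfGap125` (whose conditional forms of the same implication stay untouched).

HONEST FRAMING. Grade: COMPUTATIONAL — standard axioms + `Lean.ofReduceBool` through 323 named `native_decide`
evaluations (256 `Kissing125.KissingSearch.checkPart_eq_true_NNN` + 67 `CapX2.check*_W0625`), each the evaluation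
of a checker whose SOUNDNESS is a kernel theorem on the standard axioms. Nothing here concerns GAP(1.26), the
first-shell census, Musin–Tarasov or Flyspeck; `K = 702` (`Bulk/BulkOfGap125.lean`) is superseded by `K = 130`
and remains derivable there.

* `kissingClassification_250 : KissingClassification (5/2)` — BIMODAL(1.25): every twelve-point configuration on
  `S²(2)` with pairwise distances `2` or `≥ 5/2` is arranged in the FCC or the HCP kissing pattern
  (`Kissing125.isArrangedIn_of_isKissingConfig25`; `IsGapKissingConfig (5/2) S` and `Kissing125.IsKissingConfig25 S`
  are the same proposition).
* `bulkCrystallization3D_130 : BulkCrystallization3D 130` — **in every finite sticky-sphere ground state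
  (`IsStickyGroundState`: a unit packing of `N` balls in `ℝ³` maximising the number of contacts) all but at most
  `130 · N^{2/3}` balls are touched by exactly twelve others forming a cuboctahedron (FCC) or an anticuboctahedron
  (HCP).** Proof = GAP(1.25) in the fourteen-ball form (`CapX2.noHole_0625` → `gapTupleDiam_of_noHole` →
  `kissingGap_of_gapTuple`) + BIMODAL(1.25) (above) → two unsaturated neighbours of every non-close-packed
  twelve-ball (`two_unsaturated_of_not_isClosePackedShell_of_gap`) → the `13 · 10` counting
  (`two_mul_card_add_le_of_two_unsaturated_neighbors` + `six_mul_sub_ten_mul_rpow_le_maxContacts`), written as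
  `have`s so that no landed statement is re-declared.

## References
* T. C. Hales, arXiv:1209.6043 (2012), Theorem 3, Lemmas 8–10 (method; separation `5/2` instead of `2.52`). [`Hales2012`]
* R. C. Heitmann, C. Radin, J. Stat. Phys. 22 (1980) 281–287 (the 2D analogue). [`HeitmannRadin1980`]
-/

open Finset

namespace Summit.Ventures.Crystal3D

open Literature.Geometry.DiscreteGeometry

/-- **BIMODAL(1.25) = `KissingClassification (5/2)` HOLDS** (computational grade): every `5/2`-gap kissing
configuration — twelve points of `S²(2)`, pairwise distances `2` or `≥ 5/2` — is arranged in the FCC pattern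
(cuboctahedron) or the HCP pattern (anticuboctahedron). Hales 2012 Theorem 3 + Lemmas 9–10 re-run at the
separation `5/2` (`κ = 7/32`) by the tree's verified growth search (`Kissing125/SearchFinal.lean`:
`Kissing125.isArrangedIn_of_isKissingConfig25`). [cite: Hales2012, Theorem 3 and Lemmas 9–10 (method)] -/
theorem kissingClassification_250 : KissingClassification (5 / 2) := fun _ hS =>
  Kissing125.isArrangedIn_of_isKissingConfig25 hS

/-- **BULK CRYSTALLIZATION OF STICKY SPHERES IN `ℝ³`, `K = 130`, hypothesis-free** (computational grade:
standard axioms + the 256 + 67 named kernel evaluations of the import closure): in every finite sticky-sphere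
ground state on `N` balls — a unit packing of `ℝ³` maximising the number of contacts — all but at most
`130 · N^{2/3}` balls have a close-packed contact shell: exactly twelve touching neighbours forming an FCC
cuboctahedron or an HCP anticuboctahedron. GAP side: `CapX2.noHole_0625` (GAP(1.25), fourteen-ball form);
classification side: `kissingClassification_250`; counting: the two-unsaturated-neighbours rule with the
all-`N` fcc bound `6N − 10·N^{2/3} ≤ C(N)`. -/
theorem bulkCrystallization3D_130 : BulkCrystallization3D 130 := by
  have hdiam : GapTupleDiam 1.25 :=
    gapTupleDiam_of_noHole (h := 1.25)
      (by rw [show (1.25 : ℝ) / 2 = 0.625 by norm_num]; exact CapX2.noHole_0625)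
  have hg : KissingGap (5 / 2) := by
    have h := kissingGap_of_gapTuple ((gapTupleDiam_iff 1.25).1 hdiam)
    rw [show (2 : ℝ) * 1.25 = 5 / 2 by norm_num] at h
    exact h
  intro N x hx
  have h1 : 2 * ((nonClosePacked x).card : ℝ) + 26 * (numContacts x : ℝ) ≤ 156 * (N : ℝ) := by
    exact_mod_cast two_mul_card_add_le_of_two_unsaturated_neighbors hx.1 (D := nonClosePacked x)
      (fun i hi h12 => two_unsaturated_of_not_isClosePackedShell_of_gap hg kissingClassification_250
        hx.1 h12 (mem_nonClosePacked.1 hi))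
  have h2 := six_mul_sub_ten_mul_rpow_le_maxContacts N
  have h3 : (numContacts x : ℝ) = (maxContacts 3 N : ℝ) := by exact_mod_cast hx.2
  rw [h3] at h1
  linarith

end Summit.Ventures.Crystal3D
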